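import Summits.BirchSwinnertonDyer.Rank1Residual.X4.KuriharaLevelLoweringOfMultiplicityOneMinus
import HarnessLib

/-!
# The eigen-symbol predicates from FUNCTION-LEVEL data: Hecke relations, `Γ₀(N)`-compatibility and parity of `μ : ℚ → k` (cell `b2b-bsdres`, seat additive-p4 gen 23, line V42, file K8 — typer's bridge)

HONEST FRAMING (verbatim, cell `b2b-bsdres`): the goal of the cell is to DELETE the COMBINATION-SHAPED
residual classes for ALL analytic-rank `≤ 1` curves over `ℚ` — "full BSD formula for every rank `≤ 1`
curve in class `C`" assembled STRICTLY from published theorems — so that the rank-`≤ 1` remainder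
becomes exactly the CONSTRUCTION-SHAPED classes, which are TYPED (missing-input Props), NOT attempted;
this is not "finishing BSD". This file: research-route KERNEL BOOKKEEPING (pure algebra over the
tree's `Symb` / `hecke` and gen 23's `potSymbOf`); nothing asserted about any curve; nothing booked.

## Why

Gen 23's displayed hypotheses (OLD) `HasOldEigenPlusSymb k N θ ℓ w μ` / (OLD⁻) ask that the
`Sym⁰ k`-symbol `potSymbOf ψ` of a FUNCTION `ψ = μ − w μ∘[ℓ] : ℚ → k` lie in the `θ`-eigen plus/minus
subspace of `Symb_{Γ₀(N)}(Sym⁰ k)` (`IsEigenPlusSymb` / `IsEigenMinusSymb`). A typer vending (OLD) from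
Ribet 1990 + Ihara works with `q`-expansions and the function-level Hecke relations of Mazur–Tate–
Teitelbaum §I.4; this file is the dictionary, so that no typer has to open the `Symb` API:

* §1 `sum_potOf_heckeRep` — `Σ_{i ∈ I_q(N)} potOf μ (βᵢ x)` is `Σ_{j<q} μ((r+j)/q) (+ μ(q r) if q ∤ N)`
  at `x = r` and `0` at `∞`; hence **`hecke_potSymbOf_of_heckeRel`** (`q ∤ N`: the MTT relation
  `Σ_j μ((r+j)/q) + μ(qr) = a μ(r)` ⟹ `T_q (potSymbOf μ) = a • potSymbOf μ`) and
  **`hecke_potSymbOf_of_atkinRel`** (`q ∣ N`: `Σ_j μ((r+j)/q) = a μ(r)` ⟹ `U_q (potSymbOf μ) = a • potSymbOf μ`);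
* §2 `potSymbOf_mem_Symb_iff` — `Γ₀(N)`-invariance of `potSymbOf μ` as the cusp-transport identity
  `potOf μ (γ y) − potOf μ (γ x) = potOf μ y − potOf μ x`; `slash_iota_potSymbOf_of_even / _of_odd`;
* §3 **`isEigenPlusSymb_potSymbOf`** / **`isEigenMinusSymb_potSymbOf`** — the assembled criteria.

## References

* B. Mazur, J. Tate, J. Teitelbaum, Invent. Math. 84 (1986), §I.4 (4.2), §I.8. [cite: MazurTateTeitelbaum1986Invent, §I.4 (4.2) and §I.8]
* F. Diamond, J. Shurman, *A First Course in Modular Forms* (2005), Prop. 5.2.1, Ex. 5.2.4. [cite: DiamondShurman2005, Prop. 5.2.1 and Exercise 5.2.4]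
-/

noncomputable section

open scoped MatrixGroups ModularForm

open CongruenceSubgroup Finset Matrix

open Literature.NumberTheory.EllipticCurves Literature.NumberTheory.EllipticCurves.ModularForms
  Literature.NumberTheory.EllipticCurves.ModularForms.HidaCohomology

namespace Summit.BirchSwinnertonDyer.Rank1Residual.LevelLowering

variable {k : Type*} [CommRing k] {N : ℕ} (μ : ℚ → k)

/-! ### §1 Hecke operators on the symbol of a function -/

section Hecke

variable {q : ℕ} [Fact q.Prime]

/-- The `I_q(N)`-sum of the potential at `∞` vanishes (every `βᵢ` fixes `∞`). [folklore] -/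
theorem sum_potOf_heckeRep_infty :
    ∑ i : HeckeIdx N q, potOf μ (P1Q.act (heckeRep q i.1) P1Q.infty) = 0 := by
  haveI : NeZero q := ⟨(Fact.out : q.Prime).ne_zero⟩
  refine Finset.sum_eq_zero fun i _ ↦ ?_
  rcases i with ⟨_ | j, hi⟩
  · rw [heckeRep_none_eq_deltaMat, act_deltaMat_infty, potOf_infty]
  · rw [act_heckeRep_some_infty j, potOf_infty]

/-- **The `I_q(N)`-sum of the potential at a finite cusp**:
`Σᵢ potOf μ (βᵢ r) = Σ_{j<q} μ((r+j)/q) + (if q ∣ N then 0 else μ(q r))`.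
[cite: DiamondShurman2005, Prop. 5.2.1 and Exercise 5.2.4] -/
theorem sum_potOf_heckeRep_ofRat (r : ℚ) :
    ∑ i : HeckeIdx N q, potOf μ (P1Q.act (heckeRep q i.1) (P1Q.ofRat r)) =
      ∑ j ∈ Finset.range q, μ ((r + j) / q) + if q ∣ N then 0 else μ (q * r) := by
  haveI : NeZero q := ⟨(Fact.out : q.Prime).ne_zero⟩
  rw [sum_heckeIdx N q (fun i ↦ potOf μ (P1Q.act (heckeRep q i) (P1Q.ofRat r)))]
  congr 1
  · simp_rw [act_heckeRep_some_ofRat, potOf_ofRat, Int.cast_natCast]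
    rw [sum_zmod_val_eq_sum_fin q (fun j ↦ μ ((r + (j : ℚ)) / q)), ← Fin.sum_univ_eq_sum_range]
  · split_ifs with h
    · rfl
    · rw [heckeRep_none_eq_deltaMat, act_deltaMat_ofRat, potOf_ofRat]

/-- **`T_q (potSymbOf μ) = a • potSymbOf μ` from the Mazur–Tate–Teitelbaum relation** (`q ∤ N`):
`Σ_{j<q} μ((r+j)/q) + μ(q r) = a μ(r)` for all `r` (`HeckeRel μ q a`) implies the tree's Hecke
operator `hecke N q` acts on the symbol of `μ` by `a`. [cite: MazurTateTeitelbaum1986Invent, §I.4 (4.2)] -/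
theorem hecke_potSymbOf_of_heckeRel (hqN : ¬ q ∣ N) {a : k} (h : HeckeRel μ q a) :
    (CoeffActionOn.symPowOn (sigma0Set N) 0 k).hecke N q (potSymbOf μ) = a • potSymbOf μ := by
  haveI : NeZero q := ⟨(Fact.out : q.Prime).ne_zero⟩
  have hsum : ∀ x : P1Q, ∑ i : HeckeIdx N q, potOf μ (P1Q.act (heckeRep q i.1) x) = a * potOf μ x := by
    intro x
    rcases P1Q.infty_or_ofRat x with rfl | ⟨r, rfl⟩
    · rw [sum_potOf_heckeRep_infty, potOf_infty, mul_zero]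
    · rw [sum_potOf_heckeRep_ofRat, if_neg hqN, potOf_ofRat, h r]
  funext x y i
  rw [CoeffActionOn.hecke_apply, Finset.sum_apply, Finset.sum_apply, Finset.sum_apply]
  simp only [symPowOn_zero_slash, potSymbOf_apply, Pi.smul_apply, smul_eq_mul]
  rw [Finset.sum_sub_distrib, hsum, hsum, mul_sub]

/-- **`U_q (potSymbOf μ) = a • potSymbOf μ` from the Atkin–Lehner relation** (`q ∣ N`):
`Σ_{j<q} μ((r+j)/q) = a μ(r)` for all `r` implies `hecke N q` (`= U_q`) acts on the symbol of `μ` by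
`a`. [cite: MazurTateTeitelbaum1986Invent, §I.4 (4.2)] -/
theorem hecke_potSymbOf_of_atkinRel (hqN : q ∣ N) {a : k}
    (h : ∀ r : ℚ, ∑ j ∈ Finset.range q, μ ((r + j) / q) = a * μ r) :
    (CoeffActionOn.symPowOn (sigma0Set N) 0 k).hecke N q (potSymbOf μ) = a • potSymbOf μ := by
  haveI : NeZero q := ⟨(Fact.out : q.Prime).ne_zero⟩
  have hsum : ∀ x : P1Q, ∑ i : HeckeIdx N q, potOf μ (P1Q.act (heckeRep q i.1) x) = a * potOf μ x := by
    intro x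
    rcases P1Q.infty_or_ofRat x with rfl | ⟨r, rfl⟩
    · rw [sum_potOf_heckeRep_infty, potOf_infty, mul_zero]
    · rw [sum_potOf_heckeRep_ofRat, if_pos hqN, add_zero, potOf_ofRat, h r]
  funext x y i
  rw [CoeffActionOn.hecke_apply, Finset.sum_apply, Finset.sum_apply, Finset.sum_apply]
  simp only [symPowOn_zero_slash, potSymbOf_apply, Pi.smul_apply, smul_eq_mul]
  rw [Finset.sum_sub_distrib, hsum, hsum, mul_sub]

end Hecke

/-! ### §2 `Γ₀(N)`-invariance and parity of the symbol of a function -/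

section Level

/-- **`potSymbOf μ ∈ Symb_{Γ₀(N)}(Sym⁰ k)` iff the cusp-transport identity holds**:
`potOf μ (γ y) − potOf μ (γ x) = potOf μ y − potOf μ x` for every `γ ∈ Γ₀(N)` and all cusps `x, y`
(additivity of `potSymbOf μ` is automatic; the `Sym⁰` slash action only transports cusps).
Equivalently (take `x = ∞`): `potOf μ (γ y) = potOf μ (γ ∞) + potOf μ y`. [cite: MazurTateTeitelbaum1986Invent, §I.8] -/
theorem potSymbOf_mem_Symb_iff (S : Set (Matrix (Fin 2) (Fin 2) ℤ)) :
    potSymbOf μ ∈ (CoeffActionOn.symPowOn S 0 k).Symb (Gamma0 N) ↔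
      ∀ γ : SL(2, ℤ), γ ∈ Gamma0 N → ∀ x y : P1Q,
        potOf μ (P1Q.act (γ : Matrix (Fin 2) (Fin 2) ℤ) y) -
            potOf μ (P1Q.act (γ : Matrix (Fin 2) (Fin 2) ℤ) x) = potOf μ y - potOf μ x := by
  constructor
  · intro h γ hγ x y
    have := congrFun (congrFun (congrFun (h.2 γ hγ) x) y) 0
    rwa [symPowOn_zero_slash, potSymbOf_apply, potSymbOf_apply] at this
  · intro h
    refine ⟨fun x y z ↦ ?_, fun γ hγ ↦ ?_⟩
    · funext i
      simp only [Pi.add_apply, potSymbOf_apply]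
      ring
    · funext x y i
      rw [symPowOn_zero_slash, potSymbOf_apply, potSymbOf_apply, h γ hγ x y]

/-- **The cusp-transport identity from the `∞`-based one**: it suffices to check
`potOf μ (γ y) = potOf μ (γ ∞) + potOf μ y` for all `y`. [cite: MazurTateTeitelbaum1986Invent, §I.8] -/
theorem potSymbOf_mem_Symb_of_infty (S : Set (Matrix (Fin 2) (Fin 2) ℤ))
    (h : ∀ γ : SL(2, ℤ), γ ∈ Gamma0 N → ∀ y : P1Q,
      potOf μ (P1Q.act (γ : Matrix (Fin 2) (Fin 2) ℤ) y) =
        potOf μ (P1Q.act (γ : Matrix (Fin 2) (Fin 2) ℤ) P1Q.infty) + potOf μ y) :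
    potSymbOf μ ∈ (CoeffActionOn.symPowOn S 0 k).Symb (Gamma0 N) := by
  rw [potSymbOf_mem_Symb_iff]
  intro γ hγ x y
  rw [h γ hγ y, h γ hγ x]
  ring

/-- An EVEN function has an `ι`-invariant symbol. [cite: MazurTateTeitelbaum1986Invent, §I.8] -/
theorem slash_iota_potSymbOf_of_even (S : Set (Matrix (Fin 2) (Fin 2) ℤ)) (h : ∀ r : ℚ, μ (-r) = μ r) :
    (CoeffActionOn.symPowOn S 0 k).slash iotaMat (potSymbOf μ) = potSymbOf μ := by
  have hι : ∀ x : P1Q, potOf μ (P1Q.act iotaMat x) = potOf μ x := fun x ↦ by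
    rcases P1Q.infty_or_ofRat x with rfl | ⟨r, rfl⟩
    · rw [P1Q.act_iotaMat_infty]
    · rw [P1Q.act_iotaMat_ofRat, potOf_ofRat, potOf_ofRat, h]
  funext x y i
  rw [symPowOn_zero_slash, potSymbOf_apply, potSymbOf_apply, hι, hι]

/-- An ODD function has an `ι`-anti-invariant symbol. [cite: MazurTateTeitelbaum1986Invent, §I.8] -/
theorem slash_iota_potSymbOf_of_odd (S : Set (Matrix (Fin 2) (Fin 2) ℤ)) (h : ∀ r : ℚ, μ (-r) = -μ r) :
    (CoeffActionOn.symPowOn S 0 k).slash iotaMat (potSymbOf μ) = -potSymbOf μ := by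
  have hι : ∀ x : P1Q, potOf μ (P1Q.act iotaMat x) = -potOf μ x := fun x ↦ by
    rcases P1Q.infty_or_ofRat x with rfl | ⟨r, rfl⟩
    · rw [P1Q.act_iotaMat_infty, potOf_infty, neg_zero]
    · rw [P1Q.act_iotaMat_ofRat, potOf_ofRat, potOf_ofRat, h]
  funext x y i
  rw [symPowOn_zero_slash, Pi.neg_apply, Pi.neg_apply, Pi.neg_apply, potSymbOf_apply, potSymbOf_apply,
    hι, hι]
  ring

end Level

/-! ### §3 The assembled criteria -/

section Assembled

variable {μ}

/-- **`IsEigenPlusSymb` from function-level data**: `Γ₀(N)`-compatibility (`∞`-based cusp transport),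
the MTT Hecke relations with eigenvalue `θ q` at the primes `q ∤ N`, the Atkin–Lehner relations at
`q ∣ N`, and evenness. [cite: MazurTateTeitelbaum1986Invent, §I.4 (4.2) and §I.8] -/
theorem isEigenPlusSymb_potSymbOf (θ : ℕ → k)
    (hΓ : ∀ γ : SL(2, ℤ), γ ∈ Gamma0 N → ∀ y : P1Q,
      potOf μ (P1Q.act (γ : Matrix (Fin 2) (Fin 2) ℤ) y) =
        potOf μ (P1Q.act (γ : Matrix (Fin 2) (Fin 2) ℤ) P1Q.infty) + potOf μ y)
    (hT : ∀ q : ℕ, q.Prime → ¬ q ∣ N → HeckeRel μ q (θ q))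
    (hU : ∀ q : ℕ, q.Prime → q ∣ N → ∀ r : ℚ, ∑ j ∈ Finset.range q, μ ((r + j) / q) = θ q * μ r)
    (heven : ∀ r : ℚ, μ (-r) = μ r) : IsEigenPlusSymb k N θ (potSymbOf μ) := by
  refine ⟨potSymbOf_mem_Symb_of_infty μ _ hΓ, fun q _ hq ↦ ?_, slash_iota_potSymbOf_of_even μ _ heven⟩
  haveI : Fact q.Prime := ⟨hq⟩
  by_cases hqN : q ∣ N
  · exact hecke_potSymbOf_of_atkinRel μ hqN (hU q hq hqN)
  · exact hecke_potSymbOf_of_heckeRel μ hqN (hT q hq hqN)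

/-- **`IsEigenMinusSymb` from function-level data** (odd `μ`). [cite: MazurTateTeitelbaum1986Invent, §I.4 (4.2) and §I.8] -/
theorem isEigenMinusSymb_potSymbOf (θ : ℕ → k)
    (hΓ : ∀ γ : SL(2, ℤ), γ ∈ Gamma0 N → ∀ y : P1Q,
      potOf μ (P1Q.act (γ : Matrix (Fin 2) (Fin 2) ℤ) y) =
        potOf μ (P1Q.act (γ : Matrix (Fin 2) (Fin 2) ℤ) P1Q.infty) + potOf μ y)
    (hT : ∀ q : ℕ, q.Prime → ¬ q ∣ N → HeckeRel μ q (θ q))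
    (hU : ∀ q : ℕ, q.Prime → q ∣ N → ∀ r : ℚ, ∑ j ∈ Finset.range q, μ ((r + j) / q) = θ q * μ r)
    (hodd : ∀ r : ℚ, μ (-r) = -μ r) : IsEigenMinusSymb k N θ (potSymbOf μ) := by
  refine ⟨potSymbOf_mem_Symb_of_infty μ _ hΓ, fun q _ hq ↦ ?_, slash_iota_potSymbOf_of_odd μ _ hodd⟩
  haveI : Fact q.Prime := ⟨hq⟩
  by_cases hqN : q ∣ N
  · exact hecke_potSymbOf_of_atkinRel μ hqN (hU q hq hqN)
  · exact hecke_potSymbOf_of_heckeRel μ hqN (hT q hq hqN)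

/-- **`potSymbOf ψ ≠ 0` iff `ψ` is not identically zero.** [folklore] -/
theorem potSymbOf_ne_zero_iff {ψ : ℚ → k} : potSymbOf ψ ≠ 0 ↔ ∃ r : ℚ, ψ r ≠ 0 := by
  constructor
  · intro h
    by_contra hall
    simp only [not_exists, not_not] at hall
    apply h
    funext x y i
    rw [potSymbOf_apply, Pi.zero_apply, Pi.zero_apply, Pi.zero_apply]
    have hz : ∀ z : P1Q, potOf ψ z = 0 := fun z ↦ by
      rcases P1Q.infty_or_ofRat z with rfl | ⟨r, rfl⟩
      · exact potOf_infty ψ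
      · rw [potOf_ofRat, hall r]
    rw [hz, hz, sub_zero]
  · rintro ⟨r, hr⟩ h
    apply hr
    have := congrFun (congrFun (congrFun h P1Q.infty) (P1Q.ofRat r)) 0
    rwa [potSymbOf_infty_ofRat, Pi.zero_apply, Pi.zero_apply, Pi.zero_apply] at this

end Assembled

end Summit.BirchSwinnertonDyer.Rank1Residual.LevelLowering

end
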